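/-
Copyright: the b2b-balaban T⁴-continuum CRUX team, row NE7b leaf lineage `t4-ne7b-formalise-leaf-02` (gen 136). Project licence.
-/
import Summits.QuantumFields.BalabanUV.T4Continuum.Spine.NE7b.LocalFloorTorus
import Summits.QuantumFields.BalabanUV.T4Continuum.Spine.NE7b.FullFormSineFloorSq

/-!
# THE (h2) IMS FLOOR OF THE FULL FORM AT k = 1, U ≠ 1, WITH ITS LOCAL FLOOR SUPPLIED: `…FullFormSineFloorSq` §2 ∕ §3 (the summed-square route,
# refuter Q-v128-1 ∕ OWNER W-ne7bp1-g115-2) BY NAME with `hloc := …LocalFloorTorus.local_floor_torus` — the displayed binder `c_loc` REPLACED by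
# `c∕2 − ((2τ)²·4·2(d−1) + (2τ′(|ω|n))²·n^{d+1}·n)`; displayed now: the flat floor in the terms' currency, per-cube `U1` gauges whose gauged
# transports are `τ`-close to `1` on the terms meeting each sine-tent cube, `good ⊆` tree gauge (row NE7b, node U5c; residual (R2′) family (2),
# letter (ℓ1); E-side capstone of the (h2) slot at U ≠ 1 on the two-scale torus)

Cell `pub-balaban`, sub-cell `t4`, spine estimate NE7b (`T4WeightBudget.RelWeightBound`; the cell's OWN estimate — NOT PRINTED in [Bałaban 1983–89],
NOT PROVED).  Crux-route work under `Spine/NE7b/` by a row leaf (`t4-ne7b-formalise-leaf-02`, E-side ∕ key-readings ∕ lattice-geometry lineage, gen 136)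
under FREEZE (0)'s crux-prover clause; [folklore] junctions BY NAME (two applications); NOTHING of Bałaban's is asserted; no `def`; zero `sorry`;
no `T4Continuum/Support` leaf.
Imports: this lineage's `…LocalFloorTorus` (LFT `local_floor_torus`) and `…FullFormSineFloorSq` (FFSQ g135: `ims_floor_full_form_sq`,
`ims_floor_full_form_printed_weighted_sq` — the IMS floor with `c_loc` displayed; through it STSQ ∕ AFSQ ∕ CTL ∕ ATL ∕ ATP ∕ PTD ∕ TAI letters).

WHY.  FFSQ (and FFSF ∕ FFSP on route (A)) proved `(c_loc − (1+t⁻¹)(ε_curl + ε_avg))∕(1+t)·Σ‖x‖² ≤ Σ_P X_P(x)² + Σ_j Y_j(x)²` on `good` with every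
bookkeeping letter a tree theorem and `c_loc` — the local floor of the covariant full form on each sine-tent-localised field — DISPLAYED.  LFT proved
that local floor from letters.  THIS FILE composes the two BY NAME: §1 for FFSQ §2 (general transports `w′`, weight `ω`), §2 for FFSQ §3 (print's
(125): path transports `hol V₀ …` from ATP, `ω = √(n^{d−2})·n^{−(d+1)}`, the right side `Σ_P X_P² + n^{d−2}·Σ_j‖(Q₀(V₀)x̃)(n·y, κ)‖²`) — where the
flat letter `hflat` is EXACTLY `…FlatFullFormFloorTorus.flat_full_form_floor_torus_weighted`'s shape (HS currency) ∕ `…FlatFullFormFloorTorusOp` §2's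
(op currency of `M_m(ℂ)`, price `|m|`).

WHAT IS PROVED ([folklore]; binders = FFSQ's VERBATIM minus `{cloc} hloc`, plus LFT's displayed gauge data (`g`, `hg`, `wg`, `hwg0∕1∕2`, `base`, `wg′`,
`hwg′`, `τ`, `τ′`, `hτ`, `hτ′` on the terms meeting the sine-tent cube `S`), `hflat`, `hgood`):
* §1 **`ims_floor_full_form_sq_of_local_gauges`** — FFSQ `ims_floor_full_form_sq` with `hloc := local_floor_torus …`:
  `((c∕2 − δ) − (1+t⁻¹)(ε_curl + ε_avg))∕(1+t)·Σ_c‖x c‖² ≤ Σ_P X_P(x)² + Σ_j Y_j(x)²` on `good`,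
  `δ = (2τ)²·4·2(d−1) + (2τ′(|ω|n))²·n^{d+1}·n`, `ε_curl = (π∕2L)²·4·2(d−1)`, `ε_avg = (|ω|n)²·((d+1)(n−1)π∕2L)²·n^{d+1}·n`.
* §2 **`ims_floor_full_form_printed_weighted_sq_of_local_gauges`** — FFSQ `ims_floor_full_form_printed_weighted_sq` likewise, transports `hol V₀ …`
  (`V₀ ∈ U1` sitewise ⇒ `hw′` by `hol_mem`), `ω = √(n^{d−2})·(n^{d+1})⁻¹`, right side with `Q0cov`.

NOT HERE (honest): `hflat`'s discharge (FFFT in the HS currency — verbatim shape at this `ω` —, FFFTO §2 in the op currency of `M_m(ℂ)`; the consumer's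
currency ruling Q-leaf05-g157-1 ∕ NC-NE7b-α); the local gauges BY VALUE ((π4)∕R-V — `…LocalGaugeTransportSize`; «`Mα₀` sufficiently small», [B9] p. 428;
OWNER∕(A3)); `good` (admissibility); the curl transports `w` ∕ background `V₀` themselves ((A3)); `k > 1`; anything of Bałaban's beyond the cited PROVED
letters.  BY-NAME EFFECT ON THE WALL: NONE (the wall is (R2); this is the (h2) half of the `γ₀` assembly's input at k = 1, U ≠ 1, one finite torus,
modulo three displayed letters).  NE7b NOT PRINTED ∕ NOT PROVED; spine PROVED 0∕9; rung (B)+1 on ONE finite T⁴ — NOT infinite volume, NOT the mass gap, NOT Clay.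
HONEST DEPENDENCY: continuum YM on T⁴ ⇐ BetaPertH ∧ nine spine estimates (0/9 proved); BetaPertH ⇐ (D1) ∧ (D4) ∧ CAP+tail; G-an2-4 gates asym, D1 and NE2/3/4.
-/

set_option autoImplicit false

noncomputable section

open Finset
open Literature.MathematicalPhysics.QuantumFieldTheory.Balaban1983to89.B14.TentUnityTorus (tentZ)
open Literature.MathematicalPhysics.QuantumFieldTheory.Balaban1983to89.B7Prop1Explicit (Site seg hol treeWord boxVec U1 hol_mem)
open Literature.MathematicalPhysics.QuantumFieldTheory.Balaban1983to89.B7Eq78Linearization (conjR conjR_add conjR_smul_real)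
open Literature.MathematicalPhysics.QuantumFieldTheory.Balaban1983to89.B7Prop3GeneralLinear (Q0cov)
open Literature.MathematicalPhysics.QuantumFieldTheory.Balaban1983to89.T4TermwiseTorus (tcls)
open Literature.MathematicalPhysics.QuantumFieldTheory.Balaban1983to89.B6BondElimination (treeBonds)
open Literature.MathematicalPhysics.QuantumFieldTheory.Balaban1983to89.B6Lemma24Torus (coarseSites)
open Summit.QuantumFields.BalabanUV.T4Continuum.NE7b.FullFormSineFloorSq (ims_floor_full_form_sq ims_floor_full_form_printed_weighted_sq)
open Summit.QuantumFields.BalabanUV.T4Continuum.NE7b.LocalFloorTorus (local_floor_torus)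

namespace Summit.QuantumFields.BalabanUV.T4Continuum.NE7b.LocalFloorTorusIMS

variable {d : ℕ}
variable {𝔸 : Type*} [NormedRing 𝔸] [NormedAlgebra ℂ 𝔸] [NormOneClass 𝔸]

/-! ## §1 FFSQ §2 with the local floor supplied -/

/-- **THE (h2) IMS FLOOR OF THE FULL FORM, LOCAL FLOOR FROM LETTERS** — `…FullFormSineFloorSq.ims_floor_full_form_sq` BY NAME with
`hloc := …LocalFloorTorus.local_floor_torus`: `c_loc` becomes `c∕2 − ((2τ)²·4·2(d−1) + (2τ′(|ω|n))²·n^{d+1}·n)`; displayed: `hflat`, the per-cube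
gauges (`g`, `wg`, `wg′` characterised) with `τ`∕`τ′`-smallness on the terms meeting each sine-tent cube, `good ⊆` tree gauge. [folklore] -/
theorem ims_floor_full_form_sq_of_local_gauges (n M L Mp : ℕ) [NeZero n] [NeZero M] [NeZero (n * M)] [Fact (1 < n * M)] [NeZero Mp]
    (hL : 0 < L) (hMp : 2 ≤ Mp) (hN : n * M = Mp * L) (c₀ : ℕ)
    (ι : (Fin d → ZMod (n * M)) × {a : Fin d × Fin d // a.1 < a.2} → Fin 4 → (Fin d → ZMod (n * M)) × Fin d)
    (hι : ∀ x a, ι (x, a) = ![(x, a.1.1), (x + Pi.single a.1.1 1, a.1.2), (x + Pi.single a.1.2 1, a.1.1), (x, a.1.2)])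
    (w : (Fin d → ZMod (n * M)) × {a : Fin d × Fin d // a.1 < a.2} → Fin 3 → 𝔸ˣ) (hw : ∀ P i, w P i ∈ U1 𝔸)
    (R : (Fin d → ZMod (n * M)) × {a : Fin d × Fin d // a.1 < a.2} → (Fin d → ZMod (n * M)) × Fin d → 𝔸 →ₗ[ℝ] 𝔸)
    (hR : ∀ P c, R P c =
        if c = ι P 0 then LinearMap.id
        else if c = ι P 1 then LinearMap.mk ⟨conjR (w P 0), conjR_add (w P 0)⟩ (conjR_smul_real (w P 0))
        else if c = ι P 2 then -LinearMap.mk ⟨conjR (w P 1), conjR_add (w P 1)⟩ (conjR_smul_real (w P 1))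
        else if c = ι P 3 then -LinearMap.mk ⟨conjR (w P 2), conjR_add (w P 2)⟩ (conjR_smul_real (w P 2))
        else 0)
    (X : (Fin d → ZMod (n * M)) × {a : Fin d × Fin d // a.1 < a.2} → ((Fin d → ZMod (n * M)) → Fin d → 𝔸) → ℝ)
    (hX : ∀ (y : Fin d → ZMod (n * M)) (a : {a : Fin d × Fin d // a.1 < a.2}) (B : (Fin d → ZMod (n * M)) → Fin d → 𝔸), X (y, a) B =
      ‖B y a.1.1 + conjR (w (y, a) 0) (B (y + Pi.single a.1.1 1) a.1.2) - conjR (w (y, a) 1) (B (y + Pi.single a.1.2 1) a.1.1)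
        - conjR (w (y, a) 2) (B y a.1.2)‖)
    (ιA : (Fin d → ZMod M) × Fin d → (Fin d → Fin n) × Fin n → (Fin d → ZMod (n * M)) × Fin d)
    (hιA : ∀ y κ r t, ιA (y, κ) (r, t) =
      ((fun i => (((y i).val * n + (r i : ℕ) : ℕ) : ZMod (n * M))) + Pi.single κ ((t : ℕ) : ZMod (n * M)), κ))
    (ω : ℝ) (w' : (Fin d → ZMod M) × Fin d → (Fin d → Fin n) × Fin n → 𝔸ˣ) (hw' : ∀ j rt, w' j rt ∈ U1 𝔸)
    (R' : (Fin d → ZMod M) × Fin d → (Fin d → ZMod (n * M)) × Fin d → 𝔸 →ₗ[ℝ] 𝔸)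
    (hR' : ∀ j c, R' j c = ω • ∑ rt ∈ Finset.univ.filter (fun rt => ιA j rt = c),
        LinearMap.mk ⟨conjR (w' j rt), conjR_add (w' j rt)⟩ (conjR_smul_real (w' j rt)))
    (Y : (Fin d → ZMod M) × Fin d → ((Fin d → ZMod (n * M)) → Fin d → 𝔸) → ℝ)
    (hY : ∀ j B, Y j B = ‖ω • ∑ rt, conjR (w' j rt) (B (ιA j rt).1 (ιA j rt).2)‖)
    -- DISPLAYED: the flat floor in the terms' currency
    {c : ℝ}
    (hflat : ∀ Z : (Fin d → ZMod (n * M)) × Fin d → 𝔸,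
      (∀ y ∈ coarseSites n (fun _ : Fin d => n * M), ∀ bd ∈ treeBonds n y, Z (tcls (n * M) bd.1, bd.2) = 0) →
      c * ∑ c', ‖Z c'‖ ^ 2 ≤ ∑ P, ‖Z (ι P 0) + Z (ι P 1) - Z (ι P 2) - Z (ι P 3)‖ ^ 2 + ∑ j, ‖ω • ∑ rt, Z (ιA j rt)‖ ^ 2)
    -- DISPLAYED: the local gauges per sine-tent cube and the smallness of the gauged transports on the terms meeting it
    (g : (Fin d → ZMod Mp) → (Fin d → ZMod (n * M)) → 𝔸ˣ) (hg : ∀ S y, g S y ∈ U1 𝔸)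
    (wg : (Fin d → ZMod Mp) → (Fin d → ZMod (n * M)) × {a : Fin d × Fin d // a.1 < a.2} → Fin 3 → 𝔸ˣ)
    (hwg0 : ∀ S P, wg S P 0 = g S (ι P 0).1 * w P 0 * (g S (ι P 1).1)⁻¹)
    (hwg1 : ∀ S P, wg S P 1 = g S (ι P 0).1 * w P 1 * (g S (ι P 2).1)⁻¹)
    (hwg2 : ∀ S P, wg S P 2 = g S (ι P 0).1 * w P 2 * (g S (ι P 3).1)⁻¹)
    (base : (Fin d → ZMod M) × Fin d → (Fin d → ZMod (n * M)))
    (wg' : (Fin d → ZMod Mp) → (Fin d → ZMod M) × Fin d → (Fin d → Fin n) × Fin n → 𝔸ˣ)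
    (hwg' : ∀ S j rt, wg' S j rt = g S (base j) * w' j rt * (g S (ιA j rt).1)⁻¹)
    {τ τ' : ℝ} (hτ0 : 0 ≤ τ) (hτ0' : 0 ≤ τ')
    (hτ : ∀ S P, (∃ c' ∈ Finset.univ.image (ι P),
        (∏ ν, Real.sin (Real.pi / 2 * tentZ (L : ℝ) (c'.1 ν - (((S ν).val * L + c₀ : ℕ) : ZMod (n * M))))) ≠ 0) →
      ∀ i, ‖(wg S P i : 𝔸) - 1‖ ≤ τ)
    (hτ' : ∀ S j, (∃ c' ∈ Finset.univ.image (ιA j),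
        (∏ ν, Real.sin (Real.pi / 2 * tentZ (L : ℝ) (c'.1 ν - (((S ν).val * L + c₀ : ℕ) : ZMod (n * M))))) ≠ 0) →
      ∀ rt, ‖(wg' S j rt : 𝔸) - 1‖ ≤ τ')
    -- admissibility
    (good : ((Fin d → ZMod (n * M)) × Fin d → 𝔸) → Prop)
    (hgood : ∀ x, good x → ∀ y ∈ coarseSites n (fun _ : Fin d => n * M), ∀ bd ∈ treeBonds n y, x (tcls (n * M) bd.1, bd.2) = 0)
    {t : ℝ} (ht : 0 < t) (x : (Fin d → ZMod (n * M)) × Fin d → 𝔸) (hx : good x) :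
    (c / 2 - ((2 * τ) ^ 2 * (4 : ℕ) * (2 * (d - 1) : ℕ) + (2 * τ' * (|ω| * n)) ^ 2 * (n ^ (d + 1) : ℕ) * (n : ℕ))
        - (1 + t⁻¹) * ((1 : ℝ) ^ 2 * (Real.pi / (2 * L)) ^ 2 * (4 : ℕ) * (2 * (d - 1) : ℕ)
          + (|ω| * n) ^ 2 * (((d + 1) * (n - 1) : ℕ) * (Real.pi / (2 * L))) ^ 2 * (n ^ (d + 1) : ℕ) * (n : ℕ))) / (1 + t)
        * ∑ c', ‖x c'‖ ^ 2
      ≤ ∑ P, X P (fun y μ => x (y, μ)) ^ 2 + ∑ j, Y j (fun y μ => x (y, μ)) ^ 2 :=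
  ims_floor_full_form_sq n M L Mp hL hMp hN c₀ ι hι w hw R hR X hX ιA hιA ω w' hw' R' hR' Y hY good
    (local_floor_torus n ι hι w hw R hR ιA hιA ω w' hw' R' hR' hflat
      (fun (S : Fin d → ZMod Mp) (c' : (Fin d → ZMod (n * M)) × Fin d) =>
        ∏ ν, Real.sin (Real.pi / 2 * tentZ (L : ℝ) (c'.1 ν - (((S ν).val * L + c₀ : ℕ) : ZMod (n * M)))))
      g hg wg hwg0 hwg1 hwg2 base wg' hwg' hτ0 hτ0' hτ hτ' good hgood)
    ht x hx

/-! ## §2 FFSQ §3 (print's (125), `ω = √(n^{d−2})·n^{−(d+1)}`) with the local floor supplied -/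

/-- **THE PRINTED INSTANCE, LOCAL FLOOR FROM LETTERS** — `…FullFormSineFloorSq.ims_floor_full_form_printed_weighted_sq` BY NAME with
`hloc := local_floor_torus …` for the path transports `hol V₀ (qb y) (treeWord (boxVec n r) ++ seg κ t)` of [B7] (125) (`V₀ ∈ U1` sitewise) and
`ω = √(n^{d−2})·(n^{d+1})⁻¹`: right side `Σ_P X_P(x)² + n^{d−2}·Σ_{(y,κ)}‖(Q₀(V₀)x̃)(n·y, κ)‖²`; `hflat` here is VERBATIM the shape of
`…FlatFullFormFloorTorus.flat_full_form_floor_torus_weighted` (HS currency). [folklore] -/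
theorem ims_floor_full_form_printed_weighted_sq_of_local_gauges (n M L Mp : ℕ) [NeZero n] [NeZero M] [NeZero (n * M)]
    [Fact (1 < n * M)] [NeZero Mp]
    (hL : 0 < L) (hMp : 2 ≤ Mp) (hN : n * M = Mp * L) (c₀ : ℕ)
    (ι : (Fin d → ZMod (n * M)) × {a : Fin d × Fin d // a.1 < a.2} → Fin 4 → (Fin d → ZMod (n * M)) × Fin d)
    (hι : ∀ x a, ι (x, a) = ![(x, a.1.1), (x + Pi.single a.1.1 1, a.1.2), (x + Pi.single a.1.2 1, a.1.1), (x, a.1.2)])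
    (w : (Fin d → ZMod (n * M)) × {a : Fin d × Fin d // a.1 < a.2} → Fin 3 → 𝔸ˣ) (hw : ∀ P i, w P i ∈ U1 𝔸)
    (R : (Fin d → ZMod (n * M)) × {a : Fin d × Fin d // a.1 < a.2} → (Fin d → ZMod (n * M)) × Fin d → 𝔸 →ₗ[ℝ] 𝔸)
    (hR : ∀ P c, R P c =
        if c = ι P 0 then LinearMap.id
        else if c = ι P 1 then LinearMap.mk ⟨conjR (w P 0), conjR_add (w P 0)⟩ (conjR_smul_real (w P 0))
        else if c = ι P 2 then -LinearMap.mk ⟨conjR (w P 1), conjR_add (w P 1)⟩ (conjR_smul_real (w P 1))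
        else if c = ι P 3 then -LinearMap.mk ⟨conjR (w P 2), conjR_add (w P 2)⟩ (conjR_smul_real (w P 2))
        else 0)
    (X : (Fin d → ZMod (n * M)) × {a : Fin d × Fin d // a.1 < a.2} → ((Fin d → ZMod (n * M)) → Fin d → 𝔸) → ℝ)
    (hX : ∀ (y : Fin d → ZMod (n * M)) (a : {a : Fin d × Fin d // a.1 < a.2}) (B : (Fin d → ZMod (n * M)) → Fin d → 𝔸), X (y, a) B =
      ‖B y a.1.1 + conjR (w (y, a) 0) (B (y + Pi.single a.1.1 1) a.1.2) - conjR (w (y, a) 1) (B (y + Pi.single a.1.2 1) a.1.1)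
        - conjR (w (y, a) 2) (B y a.1.2)‖)
    (qb : (Fin d → ZMod M) → Site d) (hqb : ∀ y i, qb y i = (n : ℤ) * (((y i).val : ℕ) : ℤ))
    (ιA : (Fin d → ZMod M) × Fin d → (Fin d → Fin n) × Fin n → (Fin d → ZMod (n * M)) × Fin d)
    (hιA : ∀ y κ r t, ιA (y, κ) (r, t) =
      ((fun i => (((y i).val * n + (r i : ℕ) : ℕ) : ZMod (n * M))) + Pi.single κ ((t : ℕ) : ZMod (n * M)), κ))
    (V₀ : Site d → Fin d → 𝔸ˣ) (hV : ∀ x κ, V₀ x κ ∈ U1 𝔸)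
    (R' : (Fin d → ZMod M) × Fin d → (Fin d → ZMod (n * M)) × Fin d → 𝔸 →ₗ[ℝ] 𝔸)
    (hR' : ∀ j c, R' j c = (Real.sqrt ((n : ℝ) ^ (d - 2)) * ((n : ℝ) ^ (d + 1))⁻¹) • ∑ rt ∈ Finset.univ.filter (fun rt => ιA j rt = c),
        LinearMap.mk ⟨conjR (hol V₀ (qb j.1) (treeWord (boxVec n rt.1) ++ seg j.2 ((rt.2 : ℕ) : ℤ))),
          conjR_add (hol V₀ (qb j.1) (treeWord (boxVec n rt.1) ++ seg j.2 ((rt.2 : ℕ) : ℤ)))⟩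
          (conjR_smul_real (hol V₀ (qb j.1) (treeWord (boxVec n rt.1) ++ seg j.2 ((rt.2 : ℕ) : ℤ)))))
    -- DISPLAYED: the flat floor in the terms' currency, print's weight
    {c : ℝ}
    (hflat : ∀ Z : (Fin d → ZMod (n * M)) × Fin d → 𝔸,
      (∀ y ∈ coarseSites n (fun _ : Fin d => n * M), ∀ bd ∈ treeBonds n y, Z (tcls (n * M) bd.1, bd.2) = 0) →
      c * ∑ c', ‖Z c'‖ ^ 2 ≤ ∑ P, ‖Z (ι P 0) + Z (ι P 1) - Z (ι P 2) - Z (ι P 3)‖ ^ 2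
        + ∑ j, ‖(Real.sqrt ((n : ℝ) ^ (d - 2)) * ((n : ℝ) ^ (d + 1))⁻¹) • ∑ rt, Z (ιA j rt)‖ ^ 2)
    -- DISPLAYED: the local gauges and the smallness of the gauged transports on the terms meeting each cube
    (g : (Fin d → ZMod Mp) → (Fin d → ZMod (n * M)) → 𝔸ˣ) (hg : ∀ S y, g S y ∈ U1 𝔸)
    (wg : (Fin d → ZMod Mp) → (Fin d → ZMod (n * M)) × {a : Fin d × Fin d // a.1 < a.2} → Fin 3 → 𝔸ˣ)
    (hwg0 : ∀ S P, wg S P 0 = g S (ι P 0).1 * w P 0 * (g S (ι P 1).1)⁻¹)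
    (hwg1 : ∀ S P, wg S P 1 = g S (ι P 0).1 * w P 1 * (g S (ι P 2).1)⁻¹)
    (hwg2 : ∀ S P, wg S P 2 = g S (ι P 0).1 * w P 2 * (g S (ι P 3).1)⁻¹)
    (base : (Fin d → ZMod M) × Fin d → (Fin d → ZMod (n * M)))
    (wg' : (Fin d → ZMod Mp) → (Fin d → ZMod M) × Fin d → (Fin d → Fin n) × Fin n → 𝔸ˣ)
    (hwg' : ∀ S j rt, wg' S j rt =
      g S (base j) * hol V₀ (qb j.1) (treeWord (boxVec n rt.1) ++ seg j.2 ((rt.2 : ℕ) : ℤ)) * (g S (ιA j rt).1)⁻¹)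
    {τ τ' : ℝ} (hτ0 : 0 ≤ τ) (hτ0' : 0 ≤ τ')
    (hτ : ∀ S P, (∃ c' ∈ Finset.univ.image (ι P),
        (∏ ν, Real.sin (Real.pi / 2 * tentZ (L : ℝ) (c'.1 ν - (((S ν).val * L + c₀ : ℕ) : ZMod (n * M))))) ≠ 0) →
      ∀ i, ‖(wg S P i : 𝔸) - 1‖ ≤ τ)
    (hτ' : ∀ S j, (∃ c' ∈ Finset.univ.image (ιA j),
        (∏ ν, Real.sin (Real.pi / 2 * tentZ (L : ℝ) (c'.1 ν - (((S ν).val * L + c₀ : ℕ) : ZMod (n * M))))) ≠ 0) →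
      ∀ rt, ‖(wg' S j rt : 𝔸) - 1‖ ≤ τ')
    (good : ((Fin d → ZMod (n * M)) × Fin d → 𝔸) → Prop)
    (hgood : ∀ x, good x → ∀ y ∈ coarseSites n (fun _ : Fin d => n * M), ∀ bd ∈ treeBonds n y, x (tcls (n * M) bd.1, bd.2) = 0)
    {t : ℝ} (ht : 0 < t) (x : (Fin d → ZMod (n * M)) × Fin d → 𝔸) (hx : good x) :
    (c / 2 - ((2 * τ) ^ 2 * (4 : ℕ) * (2 * (d - 1) : ℕ)
          + (2 * τ' * (|Real.sqrt ((n : ℝ) ^ (d - 2)) * ((n : ℝ) ^ (d + 1))⁻¹| * n)) ^ 2 * (n ^ (d + 1) : ℕ) * (n : ℕ))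
        - (1 + t⁻¹) * ((1 : ℝ) ^ 2 * (Real.pi / (2 * L)) ^ 2 * (4 : ℕ) * (2 * (d - 1) : ℕ)
          + (|Real.sqrt ((n : ℝ) ^ (d - 2)) * ((n : ℝ) ^ (d + 1))⁻¹| * n) ^ 2
            * (((d + 1) * (n - 1) : ℕ) * (Real.pi / (2 * L))) ^ 2 * (n ^ (d + 1) : ℕ) * (n : ℕ))) / (1 + t)
        * ∑ c', ‖x c'‖ ^ 2
      ≤ ∑ P, X P (fun y μ => x (y, μ)) ^ 2
        + (n : ℝ) ^ (d - 2) * ∑ j : (Fin d → ZMod M) × Fin d, ‖Q0cov n V₀ (fun z ν => x (tcls (n * M) z, ν)) (qb j.1) j.2‖ ^ 2 :=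
  ims_floor_full_form_printed_weighted_sq n M L Mp hL hMp hN c₀ ι hι w hw R hR X hX qb hqb ιA hιA V₀ hV R' hR' good
    (local_floor_torus n ι hι w hw R hR ιA hιA (Real.sqrt ((n : ℝ) ^ (d - 2)) * ((n : ℝ) ^ (d + 1))⁻¹)
      (fun j rt => hol V₀ (qb j.1) (treeWord (boxVec n rt.1) ++ seg j.2 ((rt.2 : ℕ) : ℤ))) (fun _ _ => hol_mem hV _ _) R' hR' hflat
      (fun (S : Fin d → ZMod Mp) (c' : (Fin d → ZMod (n * M)) × Fin d) =>
        ∏ ν, Real.sin (Real.pi / 2 * tentZ (L : ℝ) (c'.1 ν - (((S ν).val * L + c₀ : ℕ) : ZMod (n * M)))))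
      g hg wg hwg0 hwg1 hwg2 base wg' hwg' hτ0 hτ0' hτ hτ' good hgood)
    ht x hx

end Summit.QuantumFields.BalabanUV.T4Continuum.NE7b.LocalFloorTorusIMS

end
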